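/-
Origin: expansion seat `planner-pub-hodgecm-mc-sanity-1-g2-0`, handover #2 2026-08-18T21:27Z (row RESTORED for RUN 32: prerequisite theta-3-g2 T3 #1 HodgeCM.Model.SupplyInstance as-installed fe6bb6eb3740 rides RUN 32 per packager 21:24:01Z) md5 e23928e2de8e85895bf3423a0905190a (NEW, 173 l., 8 decls; imports HodgeCM.Model.SupplyInstance ONLY (theta-3-g2 t33-mctheta3g2 #1 e4be1af74266, with its tree cone); INSTALL AFTER it; compiled rc 0 in 7 s against PKG r31 + hub tre (`HOME/mc/pub-hodgecm-mc-sanity-1-g2/lean/SupplySanity.lean`, md5 e23928e2, 173 lines);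
landed by the packager successor (mc-unitary-1-g3, gen-8 kit) in gate run 32 as `HodgeCM/Model/Sanity/SupplySanity.lean` (stripped 4 #print/#check/#eval lines).
-/
import Summits.HodgeConjecture.HodgeCM.Model.SupplyInstance_2

/-! PORT of `HodgeCM/Model/Sanity/SupplySanity.lean` (HodgeCMPerL run 82) — verbatim mechanical port; provenance in the PORT header line. -/

/-
Copyright: pub-hodgecm MODEL-CONSTRUCTION cell, 2026-08-18. Seat planner-pub-hodgecm-mc-sanity-1-g2-0 (node SAN-4 (c):
degenerate-instance sanity of the W7a-inst supply instance, OFF the E path). KERNEL ONLY: 0 records cited,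
0 hypotheses minted, 0 proof holes.

# Sanity rows for `WeilLineData` / `LineSupplyData` (theta-3-g2 `Model/SupplyInstance.lean`, md5 e4be1af74266)

Intended install path `HodgeCM/Model/Sanity/SupplySanity.lean` (additive leaf; imports only the file it tests).

QUESTION (payload SAN duty): which of the five inputs (W-ω) `ω`, (W-wt) `weight`, (W-maj) `majorants`, (W-rat)
`theta_rat`, (W-res) `Residual` of the instantiated route-(E) supply are LOAD-BEARING for its output
`∃ Γ, ∃ ω ∈ T.Theta V c k Γ, ω ≠ 0` / `T.Open_supply`, and which are satisfied by the trivial datum?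

ANSWER (kernel-checked; confirms and sharpens the owner's SAN-4 (c) hint, STATUS 21:06:15Z):
* `trivialLineData Φ_∞ x₀ hx₀ : WeilLineData K L J GU` — the TRIVIAL Weil action `ω := 1`, weight `w := 1`, over ANY
  finite extension `L/K` of number fields, index type `J`, group `GU` and archimedean test function `Φ_∞` with
  `Φ_∞(x₀) ≠ 0`: (W-wt) holds (`1 • φ_N = φ_N`), (W-rat) holds (`1 ∈ thetaStabilizerEnd`), (W-maj) holds (constant
  family: the one summable majorant is `‖Φ(ξ)‖` itself, tree `summable_norm_ratPt`).  So (W-ω), (W-wt), (W-maj),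
  (W-rat) carry NO non-degeneracy on their own.
* For this datum the theta kernel `θ_N` is CONSTANT on `U(W_j)(𝔸)` (`= Θ(φ_N)`, `trivialLineData_kernel`), the lift
  against a unitary character `χ` of `[U(W_j)]` is `Θ(φ_N) · ∫ χ dν`, and (W-res) is EQUIVALENT to
  "`Θ(φ_N) ≠ 0` for some `N > 0` ⇒ the supply conclusion" (`residual_trivialLineData_iff`): at the trivial datum
  the residual field IS the target, guarded only by one theta constant.
* Consequently `LineSupplyData T V c k` is inhabited by the trivial datum as soon as the supply conclusion holds
  and one `Θ(φ_N) ≠ 0` (`lineSupplyData_of_supply`), and `Nonempty (LineSupplyData T V c k)` ⟹ conclusion is the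
  owner's `WeilLineData.supply`; i.e. modulo the side condition the record is EXACTLY as strong as its output
  (`nonempty_lineSupplyData_iff`).  All non-degeneracy content of node W7a-inst therefore sits in the discharge of
  `res : D.Residual T V c k` for the GENUINE Weil action of node W2 (W6b: `thetaForm_ne_zero_of_thetaLift_ne_zero` …);
  a discharge of `res` from any statement implying `∃ ω ∈ Θ_k(Γ), ω ≠ 0` directly would be circular.  Nothing here
  is an objection to the file: an input record may be as strong as its output; the row records WHERE the content is.
-/

set_option autoImplicit false

noncomputable section

open MeasureTheory NumberField NumberField.mixedEmbedding
open Literature.NumberTheory.Automorphic Literature.NumberTheory.Weil1964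
open HodgeCM.PerL34.SupplyAdelic
open scoped SchwartzMap Classical

namespace HodgeCM
namespace Model
namespace SupplyInstance

section Trivial

variable {K L : Type} [Field K] [NumberField K] [Field L] [NumberField L] [Algebra K L] [FiniteDimensional K L]
variable {J : Type} [Fintype J] {GU : Type} [Group GU]

attribute [local instance] ratModule

variable (K L J GU) in
/-- **The trivial supply datum**: trivial Weil action, weight `1`, any archimedean test function non-vanishing at a
rational point.  (W-wt), (W-maj), (W-rat) are discharged by one-liners. -/
def trivialLineData (Φinf : 𝓢((J → mixedSpace K), ℂ)) (x₀ : J → K) (hx₀ : Φinf (archEmb K J x₀) ≠ 0) :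
    WeilLineData K L J GU where
  ω := 1
  Φinf := Φinf
  x₀ := x₀
  hx₀ := hx₀
  w _ := 1
  weight N t := by rw [MonoidHom.one_apply, Module.End.one_apply, one_smul]
  majorants :=
    ⟨fun Φ ξ => by simpa only [MonoidHom.one_apply, Module.End.one_apply] using continuous_const,
     fun Φ g₀ => ⟨Set.univ, Filter.univ_mem, fun ξ => ‖(Φ : (J → AdeleRing (𝓞 K) K) → ℂ) (ratPt K J ξ)‖,
       summable_norm_ratPt Φ.2, fun ξ g _ => by rw [MonoidHom.one_apply, Module.End.one_apply]⟩⟩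
  theta_rat γ _ := by rw [MonoidHom.one_apply]; exact Submonoid.one_mem _

variable (Φinf : 𝓢((J → mixedSpace K), ℂ)) (x₀ : J → K) (hx₀ : Φinf (archEmb K J x₀) ≠ 0)

/-- The trivial datum's theta kernel is the CONSTANT `Θ(φ_N)` on `U(W_j)(𝔸)`. -/
theorem trivialLineData_kernel (N : ℕ) (u : relNormOneIdeles K L) :
    (trivialLineData K L J GU Φinf x₀ hx₀).kernel N u = thetaDistLM K J (testFun K J Φinf x₀ N) := by
  rw [WeilLineData.kernel_eq]
  simp only [trivialLineData, MonoidHom.one_apply, Module.End.one_apply]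

/-- … and so is its descended kernel on `[U(W_j)]`. -/
theorem trivialLineData_kernelBar (N : ℕ) (q : relNormOneIdeles K L ⧸ relNormOneRat K L) :
    (trivialLineData K L J GU Φinf x₀ hx₀).kernelBar N q = thetaDistLM K J (testFun K J Φinf x₀ N) := by
  induction q using QuotientGroup.induction_on with
  | H u => exact (descend_mk _ _ u).trans (trivialLineData_kernel Φinf x₀ hx₀ N u)

/-- The lift of the constant kernel against a unitary character `χ` of `[U(W_j)]` is `Θ(φ_N) · ∫ χ dν`. -/
theorem trivialLineData_lift (N : ℕ) (χ : PontryaginDual (relNormOneIdeles K L ⧸ relNormOneRat K L)) :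
    (∫ q, (trivialLineData K L J GU Φinf x₀ hx₀).kernelBar N q * ((χ q : Circle) : ℂ)
        ∂(probHaarRelNormOneQuot K L)) =
      thetaDistLM K J (testFun K J Φinf x₀ N) * ∫ q, ((χ q : Circle) : ℂ) ∂(probHaarRelNormOneQuot K L) := by
  simp_rw [trivialLineData_kernelBar]
  exact integral_const_mul _ _

variable {U : Universe} (T : U.ThetaModel) {Lc : CMField} {ι₁ : Lc →+* ℂ} (V : HermSpace3 Lc ι₁) (c : SeesawCtx Lc)
  (k : Fin 4)

/-- **(W-res) at the trivial datum IS the target, guarded by one theta constant**: `Residual` holds iff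
(`Θ(φ_N) ≠ 0` for some `N > 0` ⇒ a non-zero theta one-form of type index `k` exists at some level). -/
theorem residual_trivialLineData_iff :
    (trivialLineData K L J GU Φinf x₀ hx₀).Residual T V c k ↔
      ((∃ N : ℕ, 0 < N ∧ thetaDistLM K J (testFun K J Φinf x₀ N) ≠ 0) →
        ∃ Γ : Level V, ∃ ω ∈ T.Theta V c k Γ, ω ≠ 0) := by
  constructor
  · rintro hres ⟨N, hN, hθ⟩
    refine hres N 1 hN (fun t => ?_) ?_
    · show ((((1 : PontryaginDual (relNormOneIdeles K L ⧸ relNormOneRat K L)) _ : Circle) : ℂ)) * 1 = 1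
      rw [PontryaginDual.one_apply, Circle.coe_one, one_mul]
    · rw [trivialLineData_lift]
      refine mul_ne_zero hθ ?_
      simp only [PontryaginDual.one_apply, Circle.coe_one, integral_const, probReal_univ, one_smul]
      exact one_ne_zero
  · intro H N χ hN _ hint
    refine H ⟨N, hN, fun hθ => hint ?_⟩
    rw [trivialLineData_lift, hθ, zero_mul]

end Trivial

section Record

variable {K : Type} [Field K] [NumberField K] {J : Type} [Fintype J]
variable {U : Universe} (T : U.ThetaModel) {Lc : CMField} {ι₁ : Lc →+* ℂ} (V : HermSpace3 Lc ι₁) (c : SeesawCtx Lc)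
  (k : Fin 4)

/-- **`LineSupplyData` from its own conclusion**: the trivial datum (over `L := K`, `GU := Unit`) inhabits the supply
record for type index `k` as soon as a non-zero theta one-form of type index `k` exists — given only an archimedean
test function `Φ_∞ ∈ 𝓢((K ⊗ ℝ)^J)` non-vanishing at one rational point (the guard `Θ(φ_N) ≠ 0` of
`residual_trivialLineData_iff` is not even needed in this direction). -/
def lineSupplyData_of_supply (Φinf : 𝓢((J → mixedSpace K), ℂ)) (x₀ : J → K) (hx₀ : Φinf (archEmb K J x₀) ≠ 0)
    (hΘ : ∃ Γ : Level V, ∃ ω ∈ T.Theta V c k Γ, ω ≠ 0) : LineSupplyData T V c k where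
  K := K
  L := K
  J := J
  GU := Unit
  D := trivialLineData K K J Unit Φinf x₀ hx₀
  res := (residual_trivialLineData_iff Φinf x₀ hx₀ T V c k).mpr fun _ => hΘ

/-- **The supply record is exactly as strong as its output** (given any archimedean test function non-vanishing at
one rational point, over any number field `K` and finite `J`): `Nonempty (LineSupplyData T V c k) ↔ ∃ Γ, ∃ ω ∈ Θ_k(Γ), ω ≠ 0`.
(`→` is the owner's `WeilLineData.supply`, i.e. route (E) itself; `←` is the trivial datum.) -/
theorem nonempty_lineSupplyData_iff (Φinf : 𝓢((J → mixedSpace K), ℂ)) (x₀ : J → K)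
    (hx₀ : Φinf (archEmb K J x₀) ≠ 0) :
    Nonempty (LineSupplyData T V c k) ↔ ∃ Γ : Level V, ∃ ω ∈ T.Theta V c k Γ, ω ≠ 0 :=
  ⟨fun ⟨S⟩ => S.D.supply S.res, fun hΘ => ⟨lineSupplyData_of_supply T V c k Φinf x₀ hx₀ hΘ⟩⟩

/-- In particular the hypothesis of `open_supply_of_lineSupplyData` is EQUIVALENT to `T.Open_supply` read pointwise:
line supply data of type indices `0`, `1` exist in every good context iff non-zero theta one-forms of type indices
`0`, `1` exist in every good context. -/
theorem lineSupplyData_hypothesis_iff (Φinf : 𝓢((J → mixedSpace K), ℂ)) (x₀ : J → K)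
    (hx₀ : Φinf (archEmb K J x₀) ≠ 0) :
    (∀ {Lc : CMField} {ι₁ : Lc →+* ℂ} (V : HermSpace3 Lc ι₁) (c : SeesawCtx Lc), T.GoodCtx ι₁ c →
        Nonempty (LineSupplyData T V c 0) ∧ Nonempty (LineSupplyData T V c 1)) ↔
      ∀ {Lc : CMField} {ι₁ : Lc →+* ℂ} (V : HermSpace3 Lc ι₁) (c : SeesawCtx Lc), T.GoodCtx ι₁ c →
        (∃ Γ : Level V, ∃ ω ∈ T.Theta V c 0 Γ, ω ≠ 0) ∧ ∃ Γ : Level V, ∃ ω ∈ T.Theta V c 1 Γ, ω ≠ 0 := by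
  refine ⟨fun H Lc ι₁ V c hc => ?_, fun H Lc ι₁ V c hc => ?_⟩
  · exact ⟨(nonempty_lineSupplyData_iff T V c 0 Φinf x₀ hx₀).mp (H V c hc).1,
      (nonempty_lineSupplyData_iff T V c 1 Φinf x₀ hx₀).mp (H V c hc).2⟩
  · exact ⟨(nonempty_lineSupplyData_iff T V c 0 Φinf x₀ hx₀).mpr (H V c hc).1,
      (nonempty_lineSupplyData_iff T V c 1 Φinf x₀ hx₀).mpr (H V c hc).2⟩

end Record


end SupplyInstance
end Model
end HodgeCM

end

/-! ## Axiom audit (expected: `propext`, `Classical.choice`, `Quot.sound` only) -/
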